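import Summits.CriticalPhenomena.PercolationContinuityZ3.Theorems.Transplant.FKConnectivityAllQThreePointGraded
import Literature.Probability.Percolation.FoldingFibresHarris
import Literature.Probability.Percolation.PercolationEvents
import HarnessLib

/-!
# TWO OF THE THREE crossing terms of F3 are dominated by `N(0;OVY)` — a THEOREM for all complementary pairs, by Harris–Kleitman
# on the fibre; hence `P(OV)·(P(OY) + P(VY)) ≤ P(0)·P(OVY)` for every Bernoulli product measure

Support file (`--supports stmt-CriticalPhenomena-4575`), FK sub-lane `prim-bschramm-fk-1` (generation 34) of the post-continuity
programme; builds on p205010 (kernel theorem, internal audit signed; external expert review pending).  Theorems only, UNCONDITIONAL;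
no named facts, no sorries; standard axioms.

THE ABSTRACT LEMMA (**`fibreCount_crossed_le_aligned`**).  Let `U, W` be increasing events and `(M, u)` a folding fibre (pairs
`(a, a ∆ M)` with `a ∖ M = u`).  Call a pair of the fibre ALIGNED if `a ∉ U ∪ W` and `a ∆ M ∈ U ∩ W`, CROSSED if `a ∈ U ∖ W` and
`a ∆ M ∈ W ∖ U`.  Then **#crossed ≤ #aligned**.  Proof: by inclusion–exclusion on the fibre (splitting fibre counts along `U` and `W`
and using the involution `a ↦ a ∆ M`), `#aligned − #crossed = #(a ∈ U ∩ W) − #(a ∈ U, a ∆ M ∈ W)`, and the right-hand side is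
`≥ 0` by the FIBREWISE HARRIS INEQUALITY of the tree (`FoldingFibre.fibreCount_le_of_isUpperSet`: Kleitman's lemma twice on the
sublattice `{a : a ∖ M = u}`).
THE THREE-POINT CONSEQUENCE (**`threePoint_twoOfThree`** and its two relabelled forms).  With `U = {o ~ v}` and `W = {o ~ y} ∪ {v ~ y}`:
`U ∖ W = OV`, `W ∖ U = OY ⊔ VY`, `U ∩ W = OVY`, `(U ∪ W)ᶜ = 0`, so on EVERY fibre and for ALL complementary pairs (no forest hypothesis,
no level restriction):
  **`N(OV;OY) + N(OV;VY) ≤ N(0;OVY)`**, and cyclically `N(OY;OV) + N(OY;VY) ≤ N(0;OVY)`, `N(VY;OV) + N(VY;OY) ≤ N(0;OVY)` —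
two of the three crossing terms of the (conjectural) three-point node `ThreePointFibreOn` (g34) are dominated UNCONDITIONALLY, and
summing the three forms, **`2·(N(OV;OY) + N(OV;VY) + N(OY;VY)) ≤ 3·N(0;OVY)`** (`threePoint_twoThirds`): the plain three-point fibre
inequality holds up to the factor `3/2`.  By folding fibres (**`threePoint_twoOfThree_prodBernoulli`**, `threePoint_twoThirds_prodBernoulli`):
for EVERY Bernoulli product measure on any finite graph and all `o, v, y`,
  **`P(o~v only)·(P(o~y only) + P(v~y only)) ≤ P(none joined)·P(all joined)`** and
  `2·[P(OV)P(OY) + P(OV)P(VY) + P(OY)P(VY)] ≤ 3·P(0)·P(OVY)`.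
(Harris' inequality alone gives none of these: with `P(o~v) = P(o~y) = P(v~y) = t`, `P(all) = t²` is compatible with FKG and violates
them.)  Abstract form behind it: for two increasing families `U, W` of subsets of a finite set, among the complementary pairs
`{S, Sᶜ}` separated by both `U` and `W`, those on which `U` and `W` put the SAME member inside are at least as many as those on which
they disagree (`#(U ∩ W) ≥ #(U ∩ W*)`, `W*` the complement-mirror of `W`: Harris and Kleitman).
[cite: Harris1960, Lemma 4.1] [cite: Kleitman1966, Lemma] [cite: Linusson2011, Prop. 2.6] [cite: Grimmett2006, §3.9 (pp. 63–65)]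
[cite: VandenbergHaggstromKahn2005, Thm. 1.4 (p. 7)]
-/

noncomputable section

namespace Summit.CriticalPhenomena.PercolationContinuityZ3.Theorems
namespace FK

open MeasureTheory Set Literature.Probability.LatticeModels Literature.Probability.Percolation
open scoped Classical symmDiff

variable {V : Type*} [Fintype V]

/-! ### The abstract lemma: crossed ≤ aligned for two increasing events -/

/-- **Fibrewise Harris in `fibreCount` language**: for increasing `A, B`, `#(a ∈ A, a ∆ M ∈ B) ≤ #(a ∈ A ∩ B)` on every fibre.
[cite: Harris1960, Lemma 4.1] [cite: Kleitman1966, Lemma] -/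
theorem fibreCount_le_inter_univ_of_isUpperSet {A B : Set (BondConfig V)} (hA : IsUpperSet A) (hB : IsUpperSet B)
    (M u : BondConfig V) : fibreCount M u A B ≤ fibreCount M u (A ∩ B) univ := by
  unfold fibreCount
  convert FoldingFibre.fibreCount_le_of_isUpperSet hA hB M u using 3

/-- **CROSSED ≤ ALIGNED.**  For increasing events `U, W` and every fibre `(M, u)`:
`#(a ∈ U ∖ W, a ∆ M ∈ W ∖ U) ≤ #(a ∉ U ∪ W, a ∆ M ∈ U ∩ W)`.  Inclusion–exclusion on the fibre reduces the difference to
`#(a ∈ U ∩ W) − #(a ∈ U, a ∆ M ∈ W) ≥ 0` (fibrewise Harris). [cite: Harris1960, Lemma 4.1] [cite: Kleitman1966, Lemma] [cite: Linusson2011, Prop. 2.6] -/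
theorem fibreCount_crossed_le_aligned {U W : Set (BondConfig V)} (hU : IsUpperSet U) (hW : IsUpperSet W) (M u : BondConfig V) :
    fibreCount M u (U ∩ Wᶜ) (W ∩ Uᶜ) ≤ fibreCount M u (Uᶜ ∩ Wᶜ) (U ∩ W) := by
  -- split `#(U, W)` along `W` (first class) and `U` (second class)
  have h1 : fibreCount M u U W =
      fibreCount M u (U ∩ W) (W ∩ U) + fibreCount M u (U ∩ W) (W ∩ Uᶜ) +
        (fibreCount M u (U ∩ Wᶜ) (W ∩ U) + fibreCount M u (U ∩ Wᶜ) (W ∩ Uᶜ)) := by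
    rw [fibreCount_split_left_inter M u U W W, fibreCount_split_right_inter M u (U ∩ W) W U,
      fibreCount_split_right_inter M u (U ∩ Wᶜ) W U]
  -- split `#(U ∩ W, Ω)` along `U` and `W` (second class)
  have h2 : fibreCount M u (U ∩ W) univ =
      fibreCount M u (U ∩ W) (U ∩ W) + fibreCount M u (U ∩ W) (U ∩ Wᶜ) +
        (fibreCount M u (U ∩ W) (Uᶜ ∩ W) + fibreCount M u (U ∩ W) (Uᶜ ∩ Wᶜ)) := by
    rw [fibreCount_split_right_inter M u (U ∩ W) univ U, univ_inter, univ_inter,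
      fibreCount_split_right_inter M u (U ∩ W) U W, fibreCount_split_right_inter M u (U ∩ W) Uᶜ W]
  have h3 := fibreCount_le_inter_univ_of_isUpperSet hU hW M u
  -- identify the common terms
  have e1 : fibreCount M u (U ∩ W) (W ∩ U) = fibreCount M u (U ∩ W) (U ∩ W) := by rw [inter_comm W U]
  have e2 : fibreCount M u (U ∩ W) (W ∩ Uᶜ) = fibreCount M u (U ∩ W) (Uᶜ ∩ W) := by rw [inter_comm W Uᶜ]
  have e3 : fibreCount M u (U ∩ Wᶜ) (W ∩ U) = fibreCount M u (U ∩ W) (U ∩ Wᶜ) := by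
    rw [inter_comm W U, fibreCount_swap]
  have e4 : fibreCount M u (U ∩ W) (Uᶜ ∩ Wᶜ) = fibreCount M u (Uᶜ ∩ Wᶜ) (U ∩ W) := fibreCount_swap M u _ _
  rw [h1, h2, e1, e2, e3, e4] at h3
  omega

/-! ### The three-point consequence: two of three crossing terms -/

section ThreePoint

variable (M u₀ : BondConfig V) (o v y : V)

omit [Fintype V] in
/-- `reachEv` is increasing (adding open pairs preserves reachability). [folklore] -/
theorem isUpperSet_reachEv (x w : V) : IsUpperSet (reachEv (V := V) x w) :=
  isUpperSet_openConn x w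

omit [Fintype V] in
/-- `{o~v} ∖ ({o~y} ∪ {v~y}) = OV`. [folklore] -/
theorem reachEv_inter_compl_union_eq_pattOV :
    reachEv o v ∩ (reachEv o y ∪ reachEv v y)ᶜ = pattOV o v y := by
  ext ω
  simp only [pattOV, mem_inter_iff, mem_compl_iff, mem_union, mem_reachEv, not_or]
  constructor
  · rintro ⟨h1, h2, -⟩; exact ⟨h1, h2⟩
  · rintro ⟨h1, h2⟩; exact ⟨h1, h2, fun h3 => h2 (h1.trans h3)⟩

omit [Fintype V] in
/-- `({o~y} ∪ {v~y}) ∖ {o~v} = OY ⊔ VY`. [folklore] -/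
theorem union_inter_compl_reachEv_eq :
    (reachEv o y ∪ reachEv v y) ∩ (reachEv o v)ᶜ = pattOY o v y ∪ pattVY o v y := by
  ext ω
  simp only [pattOY, pattVY, mem_inter_iff, mem_compl_iff, mem_union, mem_reachEv]
  tauto

omit [Fintype V] in
/-- `{o~v}ᶜ ∩ ({o~y} ∪ {v~y})ᶜ = 0`. [folklore] -/
theorem compl_reachEv_inter_compl_union_eq_patt0 :
    (reachEv o v)ᶜ ∩ (reachEv o y ∪ reachEv v y)ᶜ = patt0 o v y := by
  ext ω
  simp only [patt0, mem_inter_iff, mem_compl_iff, mem_union, mem_reachEv, not_or]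
  tauto

omit [Fintype V] in
/-- `{o~v} ∩ ({o~y} ∪ {v~y}) = OVY`. [folklore] -/
theorem reachEv_inter_union_eq_pattOVY :
    reachEv o v ∩ (reachEv o y ∪ reachEv v y) = pattOVY o v y := by
  ext ω
  simp only [pattOVY, mem_inter_iff, mem_union, mem_reachEv]
  constructor
  · rintro ⟨h1, h2 | h2⟩
    · exact ⟨h1, h2⟩
    · exact ⟨h1, h1.trans h2⟩
  · rintro ⟨h1, h2⟩; exact ⟨h1, Or.inl h2⟩

omit [Fintype V] in
/-- `OY` and `VY` are disjoint. [folklore] -/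
theorem disjoint_pattOY_pattVY : Disjoint (pattOY o v y) (pattVY o v y) :=
  Set.disjoint_left.2 fun _ h1 h2 => h2.1.2 h1.2

/-- **TWO OF THREE (pair `ov` singled out): `N(OV;OY) + N(OV;VY) ≤ N(0;OVY)` on every fibre, for ALL complementary pairs.**
Crossed ≤ aligned for `U = {o~v}`, `W = {o~y} ∪ {v~y}`. [cite: Harris1960, Lemma 4.1] [cite: Kleitman1966, Lemma] [cite: Linusson2011, Prop. 2.6] -/
theorem threePoint_twoOfThree :
    fibreCount M u₀ (pattOV o v y) (pattOY o v y) + fibreCount M u₀ (pattOV o v y) (pattVY o v y) ≤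
      fibreCount M u₀ (patt0 o v y) (pattOVY o v y) := by
  have key := fibreCount_crossed_le_aligned (isUpperSet_reachEv (V := V) o v)
    ((isUpperSet_reachEv (V := V) o y).union (isUpperSet_reachEv v y)) M u₀
  rw [reachEv_inter_compl_union_eq_pattOV, union_inter_compl_reachEv_eq, compl_reachEv_inter_compl_union_eq_patt0,
    reachEv_inter_union_eq_pattOVY, fibreCount_split_right M u₀ _ (disjoint_pattOY_pattVY o v y)] at key
  exact key

/-- **TWO OF THREE (pair `oy` singled out): `N(OV;OY) + N(OY;VY) ≤ N(0;OVY)`** (the `v ↔ y` relabelling of `threePoint_twoOfThree`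
and the class swap `N(OY;OV) = N(OV;OY)`). [cite: Harris1960, Lemma 4.1] [cite: Kleitman1966, Lemma] -/
theorem threePoint_twoOfThree' :
    fibreCount M u₀ (pattOV o v y) (pattOY o v y) + fibreCount M u₀ (pattOY o v y) (pattVY o v y) ≤
      fibreCount M u₀ (patt0 o v y) (pattOVY o v y) := by
  have key := threePoint_twoOfThree M u₀ o y v
  rw [pattOV_swap o v y, pattOY_swap o v y, pattVY_swap o v y, patt0_swap o v y, pattOVY_swap o v y,
    fibreCount_swap M u₀ (pattOY o v y) (pattOV o v y)] at key
  exact key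

omit [Fintype V] in
/-- `{v~y} ∖ ({o~v} ∪ {o~y}) = VY`. [folklore] -/
theorem reachEv_vy_inter_compl_union_eq_pattVY :
    reachEv v y ∩ (reachEv o v ∪ reachEv o y)ᶜ = pattVY o v y := by
  ext ω
  simp only [pattVY, mem_inter_iff, mem_compl_iff, mem_union, mem_reachEv, not_or]
  tauto

omit [Fintype V] in
/-- `({o~v} ∪ {o~y}) ∖ {v~y} = OV ⊔ OY`. [folklore] -/
theorem union_inter_compl_reachEv_vy_eq :
    (reachEv o v ∪ reachEv o y) ∩ (reachEv v y)ᶜ = pattOV o v y ∪ pattOY o v y := by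
  ext ω
  simp only [pattOV, pattOY, mem_inter_iff, mem_compl_iff, mem_union, mem_reachEv]
  constructor
  · rintro ⟨h1 | h1, h2⟩
    · exact Or.inl ⟨h1, fun h3 => h2 (h1.symm.trans h3)⟩
    · exact Or.inr ⟨fun h3 => h2 (h3.symm.trans h1), h1⟩
  · rintro (⟨h1, h2⟩ | ⟨h1, h2⟩)
    · exact ⟨Or.inl h1, fun h3 => h2 (h1.trans h3)⟩
    · exact ⟨Or.inr h2, fun h3 => h1 (h2.trans h3.symm)⟩

omit [Fintype V] in
/-- `{v~y}ᶜ ∩ ({o~v} ∪ {o~y})ᶜ = 0`. [folklore] -/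
theorem compl_reachEv_vy_inter_compl_union_eq_patt0 :
    (reachEv v y)ᶜ ∩ (reachEv o v ∪ reachEv o y)ᶜ = patt0 o v y := by
  ext ω
  simp only [patt0, mem_inter_iff, mem_compl_iff, mem_union, mem_reachEv, not_or]
  tauto

omit [Fintype V] in
/-- `{v~y} ∩ ({o~v} ∪ {o~y}) = OVY`. [folklore] -/
theorem reachEv_vy_inter_union_eq_pattOVY :
    reachEv v y ∩ (reachEv o v ∪ reachEv o y) = pattOVY o v y := by
  ext ω
  simp only [pattOVY, mem_inter_iff, mem_union, mem_reachEv]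
  constructor
  · rintro ⟨h1, h2 | h2⟩
    · exact ⟨h2, h2.trans h1⟩
    · exact ⟨h2.trans h1.symm, h2⟩
  · rintro ⟨h1, h2⟩; exact ⟨h1.symm.trans h2, Or.inl h1⟩

omit [Fintype V] in
/-- `OV` and `OY` are disjoint. [folklore] -/
theorem disjoint_pattOV_pattOY : Disjoint (pattOV o v y) (pattOY o v y) :=
  Set.disjoint_left.2 fun _ h1 h2 => h2.1 h1.1

/-- **TWO OF THREE (pair `vy` singled out): `N(OV;VY) + N(OY;VY) ≤ N(0;OVY)`** (crossed ≤ aligned for `U = {v~y}`,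
`W = {o~v} ∪ {o~y}`, and the class swap). [cite: Harris1960, Lemma 4.1] [cite: Kleitman1966, Lemma] -/
theorem threePoint_twoOfThree'' :
    fibreCount M u₀ (pattOV o v y) (pattVY o v y) + fibreCount M u₀ (pattOY o v y) (pattVY o v y) ≤
      fibreCount M u₀ (patt0 o v y) (pattOVY o v y) := by
  have key := fibreCount_crossed_le_aligned (isUpperSet_reachEv (V := V) v y)
    ((isUpperSet_reachEv (V := V) o v).union (isUpperSet_reachEv o y)) M u₀
  rw [reachEv_vy_inter_compl_union_eq_pattVY, union_inter_compl_reachEv_vy_eq, compl_reachEv_vy_inter_compl_union_eq_patt0,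
    reachEv_vy_inter_union_eq_pattOVY, fibreCount_split_right M u₀ _ (disjoint_pattOV_pattOY o v y),
    fibreCount_swap M u₀ (pattVY o v y) (pattOV o v y), fibreCount_swap M u₀ (pattVY o v y) (pattOY o v y)] at key
  exact key

/-- **TWO THIRDS OF THE THREE-POINT FIBRE INEQUALITY, unconditionally**: `2·(N(OV;OY) + N(OV;VY) + N(OY;VY)) ≤ 3·N(0;OVY)` on
every fibre (sum of the three two-of-three forms). [cite: Harris1960, Lemma 4.1] [cite: Kleitman1966, Lemma] [cite: Linusson2011, Prop. 2.6] -/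
theorem threePoint_twoThirds :
    2 * (fibreCount M u₀ (pattOV o v y) (pattOY o v y) + fibreCount M u₀ (pattOV o v y) (pattVY o v y) +
        fibreCount M u₀ (pattOY o v y) (pattVY o v y)) ≤
      3 * fibreCount M u₀ (patt0 o v y) (pattOVY o v y) := by
  have h1 := threePoint_twoOfThree M u₀ o v y
  have h2 := threePoint_twoOfThree' M u₀ o v y
  have h3 := threePoint_twoOfThree'' M u₀ o v y
  omega

end ThreePoint

/-! ### The consequences for Bernoulli product measures -/

/-- **`P(OV)·(P(OY) + P(VY)) ≤ P(0)·P(OVY)` for every Bernoulli product measure** (pair `ov` singled out; folding fibres).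
[cite: Harris1960, Lemma 4.1] [cite: Linusson2011, Prop. 2.6] [cite: Grimmett2006, §3.9 (pp. 63–65)] -/
theorem threePoint_twoOfThree_prodBernoulli (w : Sym2 V → unitInterval) (o v y : V) :
    (prodBernoulli w).real (pattOV o v y) * (prodBernoulli w).real (pattOY o v y) +
        (prodBernoulli w).real (pattOV o v y) * (prodBernoulli w).real (pattVY o v y) ≤
      (prodBernoulli w).real (patt0 o v y) * (prodBernoulli w).real (pattOVY o v y) := by
  have key := prodBernoulli_three_mul_le_of_fibrewise w (pattOV o v y) (pattOY o v y) (pattOV o v y) (pattVY o v y) ∅ ∅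
    (patt0 o v y) (pattOVY o v y) (fun M u _ => by
      have h := threePoint_twoOfThree M u o v y
      have h0 : fibreCount M u (∅ : Set (BondConfig V)) ∅ = 0 := fibreCount_eq_zero_of_forall M u _ _ fun ω _ hA _ => hA
      omega)
  have h0 : (prodBernoulli w).real (∅ : Set (BondConfig V)) = 0 := measureReal_empty
  rw [h0, mul_zero, add_zero] at key
  exact key

/-- **`P(OY)·(P(OV) + P(VY)) ≤ P(0)·P(OVY)`** (pair `oy` singled out). [cite: Harris1960, Lemma 4.1] [cite: Linusson2011, Prop. 2.6] -/
theorem threePoint_twoOfThree_prodBernoulli' (w : Sym2 V → unitInterval) (o v y : V) :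
    (prodBernoulli w).real (pattOV o v y) * (prodBernoulli w).real (pattOY o v y) +
        (prodBernoulli w).real (pattOY o v y) * (prodBernoulli w).real (pattVY o v y) ≤
      (prodBernoulli w).real (patt0 o v y) * (prodBernoulli w).real (pattOVY o v y) := by
  have key := prodBernoulli_three_mul_le_of_fibrewise w (pattOV o v y) (pattOY o v y) (pattOY o v y) (pattVY o v y) ∅ ∅
    (patt0 o v y) (pattOVY o v y) (fun M u _ => by
      have h := threePoint_twoOfThree' M u o v y
      have h0 : fibreCount M u (∅ : Set (BondConfig V)) ∅ = 0 := fibreCount_eq_zero_of_forall M u _ _ fun ω _ hA _ => hA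
      omega)
  have h0 : (prodBernoulli w).real (∅ : Set (BondConfig V)) = 0 := measureReal_empty
  rw [h0, mul_zero, add_zero] at key
  exact key

/-- **`P(VY)·(P(OV) + P(OY)) ≤ P(0)·P(OVY)`** (pair `vy` singled out). [cite: Harris1960, Lemma 4.1] [cite: Linusson2011, Prop. 2.6] -/
theorem threePoint_twoOfThree_prodBernoulli'' (w : Sym2 V → unitInterval) (o v y : V) :
    (prodBernoulli w).real (pattOV o v y) * (prodBernoulli w).real (pattVY o v y) +
        (prodBernoulli w).real (pattOY o v y) * (prodBernoulli w).real (pattVY o v y) ≤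
      (prodBernoulli w).real (patt0 o v y) * (prodBernoulli w).real (pattOVY o v y) := by
  have key := prodBernoulli_three_mul_le_of_fibrewise w (pattOV o v y) (pattVY o v y) (pattOY o v y) (pattVY o v y) ∅ ∅
    (patt0 o v y) (pattOVY o v y) (fun M u _ => by
      have h := threePoint_twoOfThree'' M u o v y
      have h0 : fibreCount M u (∅ : Set (BondConfig V)) ∅ = 0 := fibreCount_eq_zero_of_forall M u _ _ fun ω _ hA _ => hA
      omega)
  have h0 : (prodBernoulli w).real (∅ : Set (BondConfig V)) = 0 := measureReal_empty
  rw [h0, mul_zero, add_zero] at key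
  exact key

/-- **TWO THIRDS OF THE THREE-POINT INEQUALITY for every Bernoulli product measure, unconditionally**:
`2·[P(OV)P(OY) + P(OV)P(VY) + P(OY)P(VY)] ≤ 3·P(0)P(OVY)`, i.e. with `τ₃ = P(all joined)` and `u_P = P(only the pair P joined)`:
`u_{ov}u_{oy} + u_{ov}u_{vy} + u_{oy}u_{vy} ≤ (3/2)·P(none)·τ₃`. [cite: Harris1960, Lemma 4.1] [cite: Kleitman1966, Lemma]
[cite: Grimmett2006, §3.9 (pp. 63–65)] -/
theorem threePoint_twoThirds_prodBernoulli (w : Sym2 V → unitInterval) (o v y : V) :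
    2 * ((prodBernoulli w).real (pattOV o v y) * (prodBernoulli w).real (pattOY o v y) +
        (prodBernoulli w).real (pattOV o v y) * (prodBernoulli w).real (pattVY o v y) +
          (prodBernoulli w).real (pattOY o v y) * (prodBernoulli w).real (pattVY o v y)) ≤
      3 * ((prodBernoulli w).real (patt0 o v y) * (prodBernoulli w).real (pattOVY o v y)) := by
  have h1 := threePoint_twoOfThree_prodBernoulli w o v y
  have h2 := threePoint_twoOfThree_prodBernoulli' w o v y
  have h3 := threePoint_twoOfThree_prodBernoulli'' w o v y
  linarith

end FK
end Summit.CriticalPhenomena.PercolationContinuityZ3.Theorems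

end
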